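import Summits.Ventures.QEC.Census.HGPFlatten
import Summits.Ventures.QEC.Census.HGP.Core1

/-!
# Flat HGP census rows without a commutation replay

Companion to `Census/HGPFlatten.lean` (LADDER-QEC, PARTITION v2.3 item 04.HGPK bridge). There, `HGP.isCode_flat_of_eq`
takes the commutation `H_X H_Zᵀ = 0` of the literal flat lists as a hypothesis (closed per row by type-10's `commOK`
replay, `|HX|·|HZ|` popcounts — minutes in the kernel for the 150-qubit rows). It is unnecessary: the flat lists ARE
`hgpXRows` / `hgpZRows`, whose commutation `flat_comm` is the transported `HGP.HX_mul_HZ_transpose` (TZ Prop. 3).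
`flat_comm_of_eq` substitutes the list identities, and `HGP.isCode_flat` states `[[n, k, d]]` for the literal lists with
that generic commutation proof — per row only the two list identities `hgpXRows … = HX`, `hgpZRows … = HZ` remain
(`decide +kernel`, seconds). [folklore]
-/

namespace Summit.Ventures.QEC.Census

open Matrix Literature.InformationTheory.QuantumCodes

/-- Commutation of literal flat check lists that are the flat lists of `HGP(H₁,H₂)` — from `flat_comm` by substitution,
no replay. [folklore] -/
theorem flat_comm_of_eq (n₁ n₂ : ℕ) (H₁ H₂ : List ℕ) {N : ℕ} {HXl HZl : List ℕ}
    (hN : n₁ * n₂ + H₁.length * H₂.length = N) (hX : hgpXRows n₁ n₂ H₁ H₂ = HXl) (hZ : hgpZRows n₁ n₂ H₁ H₂ = HZl) :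
    rowMatrix N HXl * (rowMatrix N HZl)ᵀ = 0 := by
  subst hN hX hZ
  exact flat_comm n₁ n₂ H₁ H₂

/-- **Flat `[[n,k,d]]` with literal check lists, commutation included.** If the flat lists of `HGP(H₁,H₂)` evaluate to
the numerals `HXl`, `HZl`, then the CSS code with check matrices `rowMatrix N HXl`, `rowMatrix N HZl` (commutation by
`flat_comm_of_eq`) is `[[n, k, d]]` whenever `HGP.code (rowMatrix n₁ H₁) (rowMatrix n₂ H₂)` is. [folklore] -/
theorem HGP.isCode_flat (n₁ n₂ : ℕ) (H₁ H₂ : List ℕ) {N : ℕ} {HXl HZl : List ℕ}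
    (hN : n₁ * n₂ + H₁.length * H₂.length = N) (hX : hgpXRows n₁ n₂ H₁ H₂ = HXl) (hZ : hgpZRows n₁ n₂ H₁ H₂ = HZl)
    {n k d : ℕ} (h : (Summit.Ventures.QEC.HGP.code (rowMatrix n₁ H₁) (rowMatrix n₂ H₂)).IsCode n k d) :
    (CSSCode.ofMatrices (rowMatrix N HXl) (rowMatrix N HZl) (flat_comm_of_eq n₁ n₂ H₁ H₂ hN hX hZ)).IsCode n k d :=
  HGP.isCode_flat_of_eq n₁ n₂ H₁ H₂ hN hX hZ _ h

/-- CONTROL: the flat `[[27, 4, 3]]` of census row `HGP_rep3_x_ham3` (gens `matrix_sha256 = 31756321…`), literal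
check lists, commutation generic, list identities by `decide`. [folklore] -/
theorem isCodeFlat_rep3_ham3_control :
    (CSSCode.ofMatrices
      (rowMatrix 27 [2097281, 4194562, 6291972, 8389640, 10487824, 12587040, 14688320, 16793728, 33587456, 50397696,
        67240960, 84150272, 101191680, 118497280])
      (rowMatrix 27 [2097237, 4194406, 8388728, 18885248, 37761792, 75512832, 18169856, 35225600, 69074944])
      (flat_comm_of_eq 3 7 [3, 6] [85, 102, 120] (by decide) hgpXRows_rep3_ham3 hgpZRows_rep3_ham3)).IsCode 27 4 3 :=
  HGP.isCode_flat 3 7 [3, 6] [85, 102, 120] (by decide) hgpXRows_rep3_ham3 hgpZRows_rep3_ham3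
    HGP.isCode_HGP_rep3_x_ham3

end Summit.Ventures.QEC.Census
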